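import Summits.ValiantsHypothesis.ValiantsHypothesis.Theorems.SymmetroidPencilBasics
import Summits.ValiantsHypothesis.ValiantsHypothesis.Theorems.LacunarySymmetroidMatrixDescartesStubReverse

/-!
# `WeakLifting`, line (B) `tower_graft` — calibration at `m = 3` on a SECOND, STEEPER 3-tower: `Z₊ ≥ 10 > 3m` on `(0, 1, 6, 36)`

Crux `stmt-ValiantsHypothesis-19561` (`Theses.KPlusLogSqLaw.WeakLifting`), restricted sub-case of the line
`Cruxes/WeakLifting/Lines/tower_graft.lean` (tower supports `IsTower m d : ∀ l < l', m·d l < d l'`).  Companion of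
`…TowerGraftTowerTwoSidedWitness` (`T₂₄`: `Z₊ ≥ 6 = 3m` at `m = 2` on the 2-tower `(0,1,3,7)`) and of
`…TowerGraftTowerTwoSidedWitnessThree` (`T₃`: `Z₊ ≥ 8 > 2m` at `m = 3` on the 3-tower `(0,1,4,13)`), same word
`X^e • J + ∑ₖ X^{dₖ} • Pₖ` (`Pₖ ⪰ 0`, ONE symmetric pivot letter `J`, four letters).  This file REPLICATES the kernel datum «TOWER TEN AT m = 3» of `…TowerTwoSidedWitnessTen` (`T₁₀`, p681233, support `(0,1,5,25)`,
pivot inertia `(2+,1−)`) on a SECOND, STEEPER support and with the OTHER pivot inertia: on the genuine 3-tower `(0, 1, 6, 36)`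
(`3·0 < 1`, `3·1 < 6`, `3·6 < 36`; it is even a 5-tower) the `3 × 3` pencil `T(X) = X¹ • J + X⁰ • P₀ + X⁶ • P₆ + X³⁶ • P₃₆` with PSD
letters `Pₖ = Lₖ Lₖᵀ` (columns `uₖ`, `u'ₖ`, `u''ₖ` of the integer lower-triangular `Lₖ`; `P₀`, `P₆` full rank, `P₃₆` rank two) and the INDEFINITE pivot
`J` (`J₁₁ < 0 < J₀₀`, `det J > 0`: inertia `(1+, 2−)`) at the exponent `1` has `det T` alternating in sign at the eleven rational points
`1/4 < 1/2 < 5/8 < 3/4 < 7/8 < 31/32 < 1 < 17/16 < 9/8 < 3/2 < 7` (`+,−,+,−,+,−,+,−,+,−,+`), hence `Z₊ ≥ 10 > 9 = 3m` (`ten_le_card_posRoots_T₃₆`, `exists_tower_twoSided_gt_three_mul_card_three_steep`; the law-shaped negation is already p681233's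
`not_towerTwoSidedLaw_three_mul_three`, not restated).  Provenance: compute note
`liftp3-m4-tower-v2` of the cell `pub-symmetroid` (j321930, task `B-m3-0_1_6_36-p1-6p2-Z11-r1`, seeded from a `2 × 2` six ⊕ a `1 × 1`
two and coupled; exact rational certificate there, `(Z, E, max n₋) = (10, 5, 1)`), integerised in-seat at scale `128` (`L`) / `128²`
(`J`), the eleven signs re-verified in exact arithmetic before typing.  So the located/kernel `m = 3` cell `10` does not depend on the
support `(0,1,5,25)` nor on the pivot inertia.  Harmless to `TowerB` (inside every registered stub's additive slack).

[folklore] Elementary; the sign pattern is a `norm_num` certificate at rational points.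
-/

-- `Summit.ValiantsHypothesis.ValiantsHypothesis.…` repeats a component by the D-0017 layout
-- (single-conjunct summit), which the `dupNamespace` linter flags; the name is mandated.
set_option linter.dupNamespace false

namespace Summit.ValiantsHypothesis.ValiantsHypothesis.Theorems.KPlusLogSqLaw.TowerGraft

open Summit.ValiantsHypothesis.ValiantsHypothesis.Theorems.SymmetroidDescartes
  (le_card_posRoots_of_alternating)
open Summit.ValiantsHypothesis.ValiantsHypothesis.Theorems.LacunarySymmetroidMatrixDescartes (StubReverse.eval_det_pencil)
open scoped BigOperators Matrix
open Polynomial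

namespace TowerTwoSidedWitnessTenSteep

/-- the vectors `uₖ` (first columns of the integer lower-triangular factors `Lₖ`) -/
def u₃₆ : Fin 3 → Fin 3 → ℝ := ![![-1560, -1466, 3], ![-2993, 1420, -43], ![490, -270, 65]]

/-- the vectors `u'ₖ` (second columns of the Cholesky-type factors) -/
def u'₃₆ : Fin 3 → Fin 3 → ℝ := ![![0, -71, 69], ![0, -93, -112], ![0, 0, -5]]

/-- the vectors `u''ₖ` (third columns) -/
def u''₃₆ : Fin 3 → Fin 3 → ℝ := ![![0, 0, -1], ![0, 0, 11], ![0, 0, -71]]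

/-- the three PSD letters `Pₖ = uₖ uₖᵀ + u'ₖ u'ₖᵀ + u''ₖ u''ₖᵀ` (= `Lₖ Lₖᵀ`) -/
def P₃₆ (k : Fin 3) : Matrix (Fin 3) (Fin 3) ℝ :=
  Matrix.vecMulVec (u₃₆ k) (u₃₆ k) + Matrix.vecMulVec (u'₃₆ k) (u'₃₆ k) + Matrix.vecMulVec (u''₃₆ k) (u''₃₆ k)

/-- their exponents `(0, 6, 36)` -/
def d₃₆ : Fin 3 → ℕ := ![0, 6, 36]

/-- the pivot exponent `e = 1` (ONE PSD exponent below it, TWO above) -/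
def e₃₆ : ℕ := 1

/-- the indefinite pivot letter `J` (inertia `(1+, 2−)`) -/
def J₃₆ : Matrix (Fin 3) (Fin 3) ℝ :=
  !![1485943, -1626503, 76440; -1626503, -3142735, 41295; 76440, 41295, -7733]

/-- the witness pencil `T(X) = X^1 • J + ∑ₖ X^{dₖ} • Pₖ` on the 3-tower `(0, 1, 6, 36)`, in the currency of
`stub_twoSided` -/
noncomputable def T₃₆ : Matrix (Fin 3) (Fin 3) ℝ[X] :=
  ((X : ℝ[X]) ^ e₃₆) • J₃₆.map Polynomial.C + ∑ k, ((X : ℝ[X]) ^ d₃₆ k) • (P₃₆ k).map Polynomial.C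

/-- `J` is symmetric -/
theorem J₃₆_isSymm : J₃₆.IsSymm := by
  unfold Matrix.IsSymm J₃₆
  ext i j
  fin_cases i <;> fin_cases j <;> simp

/-- `J` is not negative semidefinite: a positive diagonal entry -/
theorem J₃₆_apply_zero_zero_pos : 0 < J₃₆ 0 0 := by
  simp [J₃₆]

/-- … and not positive semidefinite: a negative diagonal entry -/
theorem J₃₆_apply_one_one_neg : J₃₆ 1 1 < 0 := by
  simp [J₃₆]

/-- `0 < det J` (so, `J` being indefinite, it has ONE positive and TWO negative eigenvalues: the other inertia than `T₁₀`'s) -/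
theorem det_J₃₆_pos : 0 < J₃₆.det := by
  simp [J₃₆, Matrix.det_fin_three]
  norm_num

/-- every `Pₖ` is positive semidefinite -/
theorem P₃₆_posSemidef (k : Fin 3) : (P₃₆ k).PosSemidef := by
  have h1 := Matrix.posSemidef_vecMulVec_self_star (R := ℝ) (u₃₆ k)
  have h2 := Matrix.posSemidef_vecMulVec_self_star (R := ℝ) (u'₃₆ k)
  have h3 := Matrix.posSemidef_vecMulVec_self_star (R := ℝ) (u''₃₆ k)
  rw [star_trivial] at h1 h2 h3
  exact (h1.add h2).add h3

/-- the witness is two-sided: PSD exponents on both sides of the pivot -/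
theorem twoSided₃₆ : (∃ k, d₃₆ k < e₃₆) ∧ (∃ k, e₃₆ < d₃₆ k) :=
  ⟨⟨0, by simp [d₃₆, e₃₆]⟩, ⟨2, by simp [d₃₆, e₃₆]⟩⟩

/-- the support `{e} ∪ {dₖ}` = `(0, 1, 6, 36)` is a genuine 3-TOWER (`3·x < y` for all exponents `x < y`; this is
`TowerGraftLine.IsTower 3` of line (B) for the sorted exponent vector), stated pairwise -/
theorem tower₃₆ : (∀ k, d₃₆ k < e₃₆ → 3 * d₃₆ k < e₃₆) ∧ (∀ k, e₃₆ < d₃₆ k → 3 * e₃₆ < d₃₆ k) ∧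
    (∀ k k', d₃₆ k < d₃₆ k' → 3 * d₃₆ k < d₃₆ k') := by
  refine ⟨?_, ?_, ?_⟩
  · intro k; fin_cases k <;> simp [d₃₆, e₃₆]
  · intro k; fin_cases k <;> simp [d₃₆, e₃₆]
  · intro k k'; fin_cases k <;> fin_cases k' <;> simp [d₃₆]

/-- `det T(t)` in closed form (cofactor expansion of the symmetric `3 × 3` matrix of entry polynomials) -/
theorem eval_det_T₃₆ (t : ℝ) :
    (T₃₆.det).eval t =
      (2433600 + 1485943 * t + 8958049 * t ^ 6 + 240100 * t ^ 36) *
          ((2154197 - 3142735 * t + 2025049 * t ^ 6 + 72900 * t ^ 36) *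
              (4771 - 7733 * t + 14514 * t ^ 6 + 9291 * t ^ 36) -
            (-9297 + 41295 * t - 50644 * t ^ 6 - 17550 * t ^ 36) ^ 2) -
        (2286960 - 1626503 * t - 4250060 * t ^ 6 - 132300 * t ^ 36) *
          ((2286960 - 1626503 * t - 4250060 * t ^ 6 - 132300 * t ^ 36) *
              (4771 - 7733 * t + 14514 * t ^ 6 + 9291 * t ^ 36) -
            (-9297 + 41295 * t - 50644 * t ^ 6 - 17550 * t ^ 36) *
              (-4680 + 76440 * t + 128699 * t ^ 6 + 31850 * t ^ 36)) +
        (-4680 + 76440 * t + 128699 * t ^ 6 + 31850 * t ^ 36) *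
          ((2286960 - 1626503 * t - 4250060 * t ^ 6 - 132300 * t ^ 36) *
              (-9297 + 41295 * t - 50644 * t ^ 6 - 17550 * t ^ 36) -
            (2154197 - 3142735 * t + 2025049 * t ^ 6 + 72900 * t ^ 36) *
              (-4680 + 76440 * t + 128699 * t ^ 6 + 31850 * t ^ 36)) := by
  unfold T₃₆
  rw [StubReverse.eval_det_pencil]
  simp only [Matrix.det_fin_three, Fin.sum_univ_three, Matrix.add_apply, Matrix.smul_apply, P₃₆, u₃₆, u'₃₆, u''₃₆, J₃₆, d₃₆,
    e₃₆, Matrix.vecMulVec_apply, Matrix.cons_val_zero, Matrix.cons_val_one, Matrix.cons_val_two, Function.comp_apply,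
    Fin.succ_zero_eq_one, Matrix.of_apply, Matrix.cons_val', Matrix.empty_val', Matrix.cons_val_fin_one,
    Matrix.vecHead, Matrix.vecTail, smul_eq_mul, pow_zero, pow_one, one_mul]
  ring

/-- eleven positive test points -/
noncomputable def τ₃₆ : Fin 11 → ℝ := ![1/4, 1/2, 5/8, 3/4, 7/8, 31/32, 1, 17/16, 9/8, 3/2, 7]

/-- the test points increase -/
theorem τ₃₆_strictMono : StrictMono τ₃₆ := by
  refine Fin.strictMono_iff_lt_succ.2 fun j => ?_
  fin_cases j <;> simp [τ₃₆] <;> norm_num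

/-- the test points are positive -/
theorem τ₃₆_pos (j : Fin 11) : 0 < τ₃₆ j := by
  fin_cases j <;> simp [τ₃₆]

/-- `det T` alternates in sign along the test points (signs `+,−,+,−,+,−,+,−,+,−,+`; `norm_num` certificate) -/
theorem alt₃₆ (j : Fin 10) :
    (T₃₆.det).eval (τ₃₆ j.castSucc) * (T₃₆.det).eval (τ₃₆ j.succ) < 0 := by
  fin_cases j <;> simp only [eval_det_T₃₆, τ₃₆] <;> simp <;> norm_num

/-- **`Z₊ ≥ 10`** for the two-sided `3 × 3` witness on the steep 3-tower `(0, 1, 6, 36)`. -/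
theorem ten_le_card_posRoots_T₃₆ :
    10 ≤ (T₃₆.det.roots.toFinset.filter (fun t => 0 < t)).card :=
  le_card_posRoots_of_alternating _ 10 τ₃₆ τ₃₆_strictMono τ₃₆_pos alt₃₆

end TowerTwoSidedWitnessTenSteep

open TowerTwoSidedWitnessTenSteep

/-- The same witness existentially, in the vocabulary of `stub_twoSided` plus the 3-tower condition: a symmetric `J`
with `J₁₁ < 0 < J₀₀` (indefinite) and `0 < det J`, PSD `Pₖ` on BOTH sides of the pivot, a 3-tower support, and MORE
than `3 · card ι` positive zeros. -/
theorem exists_tower_twoSided_gt_three_mul_card_three_steep :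
    ∃ (e : ℕ) (d : Fin 3 → ℕ) (J : Matrix (Fin 3) (Fin 3) ℝ) (P : Fin 3 → Matrix (Fin 3) (Fin 3) ℝ),
      J.IsSymm ∧ 0 < J 0 0 ∧ J 1 1 < 0 ∧ 0 < J.det ∧ (∀ k, (P k).PosSemidef) ∧ (∃ k, d k < e) ∧ (∃ k, e < d k) ∧
        (∀ k, d k < e → 3 * d k < e) ∧ (∀ k, e < d k → 3 * e < d k) ∧ (∀ k k', d k < d k' → 3 * d k < d k') ∧
        3 * Fintype.card (Fin 3) <
          ((Matrix.det (((X : ℝ[X]) ^ e) • J.map Polynomial.C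
              + ∑ k, ((X : ℝ[X]) ^ d k) • (P k).map Polynomial.C)).roots.toFinset.filter
                (fun t => 0 < t)).card :=
  ⟨e₃₆, d₃₆, J₃₆, P₃₆, J₃₆_isSymm, J₃₆_apply_zero_zero_pos, J₃₆_apply_one_one_neg, det_J₃₆_pos, P₃₆_posSemidef,
    twoSided₃₆.1, twoSided₃₆.2, tower₃₆.1, tower₃₆.2.1, tower₃₆.2.2, by
    have h10 := ten_le_card_posRoots_T₃₆
    simp only [Fintype.card_fin]
    exact lt_of_lt_of_le (by norm_num) h10⟩

end Summit.ValiantsHypothesis.ValiantsHypothesis.Theorems.KPlusLogSqLaw.TowerGraft
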